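import Summits.CriticalPhenomena.PercolationContinuityZ3.Theorems.PercNearOneGluingNoHeavyLowerTailSahiPivotFamily
import Mathlib
import HarnessLib
import HarnessLib.Audit.Tags

/-!
# `NoHeavyLowerTail` (crux stmt-CriticalPhenomena-4575), master-family line P1 (gen 15):
# REFUTATION of the typed conjectures `PivotFamilyNonneg 3` and `LowerSectionDomination 3` of `…SahiPivotFamily`

Support file (seat `prim-masterthm-p1`, gen 15, same session as the conjectures; `--supports stmt-CriticalPhenomena-4575`).
Memo `run/shared/lean/prim/prim-masterthm/FROM-prim-masterthm-p1-g15-PIVOT-FAMILY.md` §10 (retraction).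

THE WITNESS ("dual standard system composed with OR-blocks").  Blocks `B₁ = {0,1,2}`, `B₂ = {3,4}`, `B₃ = {5,6}`; `yᵢ(X) := [X ∩ Bᵢ ≠ ∅]`;
generators `G₁ = y₂ ∧ y₃`, `G₂ = y₁ ∧ y₃`, `G₃ = y₁ ∧ y₂`; the sunflower labeling `F7` = (≥ two `Gᵢ` ↦ `A`, exactly `Gᵢ` ↦ `Cᵢ`, none ↦ `B`),
i.e. `A` iff all three blocks are hit, `Cᵢ` iff exactly the two blocks other than `Bᵢ` are hit, `B` iff at most one block is hit.  Then
`Ψ^{S}_{U}(F7) = pivotSum {0,…,6} {3,4,5,6} F7 = −18 < 0`: the member "pivots inside the two small blocks" of the pivot family FAILS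
(`not_pivotFamilyNonneg_three`).  The same construction with three blocks of size `2` on `{0,…,5}` gives
`pivotSum {0,…,5} {0,…,4} F6 = 28 < 30 = pivotSum {0,…,4} {0,…,4} F6`, refuting lower-section domination (`not_lowerSectionDomination_three`).
(The pivot family, its member (**), M, facet domination are nevertheless TRUE for every labeling of `2^≤5` — exhaustive census in the memo —
and the top member CP3⁺ is positive on all these witnesses: `pivotSum S S F7 = 66`.)  Both inequalities are closed decidable computations
(`decide`). [this work]
-/

namespace Summit.CriticalPhenomena.PercolationContinuityZ3.Theorems

namespace SahiPivotFamily

open Finset AntipodalStrongHarris AntipodalStrongHarris.Lab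

/-- The label of a triple of generator indicators: `A` if at least two hold, `Cᵢ` if exactly `Gᵢ` holds, `B` if none. [this work] -/
def lab3 (g₁ g₂ g₃ : Bool) : Lab 3 :=
  if (g₁ && g₂) || (g₁ && g₃) || (g₂ && g₃) then top
  else if g₁ then petal 0 else if g₂ then petal 1 else if g₃ then petal 2 else bot

/-- `lab3` is monotone in the three indicators (for the order `B < Cᵢ < A`). [this work] -/
theorem lab3_mono {g₁ g₂ g₃ h₁ h₂ h₃ : Bool} (e₁ : g₁ = true → h₁ = true) (e₂ : g₂ = true → h₂ = true)
    (e₃ : g₃ = true → h₃ = true) : lab3 g₁ g₂ g₃ ≤ lab3 h₁ h₂ h₃ := by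
  rw [le_def]
  revert e₁ e₂ e₃
  cases g₁ <;> cases g₂ <;> cases g₃ <;> cases h₁ <;> cases h₂ <;> cases h₃ <;> simp [lab3]

/-- The witness on seven coordinates: blocks `{0,1,2}`, `{3,4}`, `{5,6}`, `Gᵢ` = "both other blocks are hit". [this work] -/
def F7 (X : Finset ℕ) : Lab 3 :=
  lab3 ((decide (3 ∈ X) || decide (4 ∈ X)) && (decide (5 ∈ X) || decide (6 ∈ X)))
       ((decide (0 ∈ X) || decide (1 ∈ X) || decide (2 ∈ X)) && (decide (5 ∈ X) || decide (6 ∈ X)))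
       ((decide (0 ∈ X) || decide (1 ∈ X) || decide (2 ∈ X)) && (decide (3 ∈ X) || decide (4 ∈ X)))

/-- The witness on six coordinates: blocks `{0,1}`, `{2,3}`, `{4,5}`. [this work] -/
def F6 (X : Finset ℕ) : Lab 3 :=
  lab3 ((decide (2 ∈ X) || decide (3 ∈ X)) && (decide (4 ∈ X) || decide (5 ∈ X)))
       ((decide (0 ∈ X) || decide (1 ∈ X)) && (decide (4 ∈ X) || decide (5 ∈ X)))
       ((decide (0 ∈ X) || decide (1 ∈ X)) && (decide (2 ∈ X) || decide (3 ∈ X)))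

/-- `F7` is a sunflower labeling (monotone). [this work] -/
theorem F7_mono : ∀ ⦃X Y : Finset ℕ⦄, X ⊆ Y → F7 X ≤ F7 Y := by
  intro X Y hXY
  unfold F7
  have h : ∀ n : ℕ, decide (n ∈ X) = true → decide (n ∈ Y) = true := fun n hn => by
    simp only [decide_eq_true_eq] at hn ⊢; exact hXY hn
  apply lab3_mono <;> simp only [Bool.and_eq_true, Bool.or_eq_true] <;> aesop

/-- `F6` is a sunflower labeling (monotone). [this work] -/
theorem F6_mono : ∀ ⦃X Y : Finset ℕ⦄, X ⊆ Y → F6 X ≤ F6 Y := by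
  intro X Y hXY
  unfold F6
  have h : ∀ n : ℕ, decide (n ∈ X) = true → decide (n ∈ Y) = true := fun n hn => by
    simp only [decide_eq_true_eq] at hn ⊢; exact hXY hn
  apply lab3_mono <;> simp only [Bool.and_eq_true, Bool.or_eq_true] <;> aesop

/-- The failing member of the pivot family: pivots inside the two small blocks, on the seven-coordinate witness. [this work] -/
theorem pivotSum_F7_neg : pivotSum ({0,1,2,3,4,5,6} : Finset ℕ) ({3,4,5,6} : Finset ℕ) F7 = -18 := by
  decide +kernel

/-- **REFUTATION of the pivot family (`k = 3`).** [this work] -/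
theorem not_pivotFamilyNonneg_three : ¬ PivotFamilyNonneg 3 := by
  intro h
  have := h {0,1,2,3,4,5,6} {3,4,5,6} F7 F7_mono (by decide)
  rw [pivotSum_F7_neg] at this
  exact absurd this (by norm_num)

/-- The failing instance of lower-section domination on the six-coordinate witness: adding the coordinate `5` to the cubes of the
pivots inside `{0,…,4}` LOWERS the functional from `30` to `28`. [this work] -/
theorem pivotSum_F6_lt : pivotSum ({0,1,2,3,4,5} : Finset ℕ) ({0,1,2,3,4} : Finset ℕ) F6 = 28 ∧
    pivotSum ({0,1,2,3,4} : Finset ℕ) ({0,1,2,3,4} : Finset ℕ) F6 = 30 := by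
  constructor <;> decide +kernel

/-- **REFUTATION of lower-section domination (`k = 3`).** [this work] -/
theorem not_lowerSectionDomination_three : ¬ LowerSectionDomination 3 := by
  intro h
  have h56 : insert 5 ({0,1,2,3,4} : Finset ℕ) = ({0,1,2,3,4,5} : Finset ℕ) := by decide
  have := h {0,1,2,3,4} 5 F6 (by decide) F6_mono
  rw [h56, pivotSum_F6_lt.1, pivotSum_F6_lt.2] at this
  exact absurd this (by norm_num)

end SahiPivotFamily

end Summit.CriticalPhenomena.PercolationContinuityZ3.Theorems
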